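import Literature.Geometry.Kaehler.ComplexTorusIdempotentRelations
import Literature.Geometry.Kaehler.ComplexTorusProductHomRank
import Literature.Geometry.Kaehler.ComplexTorusZarhinTrick
import Mathlib.GroupTheory.SpecificGroups.KleinFour
import HarnessLib

/-!
# Finite groups in `End_ℚ(X)`: the idempotents `ε_H` and Kani–Rosen's Theorem B
# (`X^{m-1} × (X^{ε_G})^{|G|} ∼ ∏_i (X^{ε_{H_i}})^{|H_i|}` for a partition of `G` by subgroups)

Layer `Literature/Geometry/Kaehler`, namespace `Literature.Geometry.Kaehler.ComplexTorus`; lane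
`lit-hodgefound`, Layer A2, row «A2-27(ad)» (self-proposed 2026-08-22, seat `lit-hodgefound-p10`,
generation 5).  Sequel of `ComplexTorusIdempotentRelations.lean` (this seat, row «A2-27(ac)»: the
`ℚ`-characters `χ_S = homCharacter S Φ` with `χ_S(ε) = dim_ℚ Hom_ℚ(S, X^ε)`, the torus `X^ε = idemPeriod Φ ε`,
the Hom-count isogeny criterion `IsAbelianVariety.isIsogenous_of_forall_finrank_homRat_eq`, and
Kani–Rosen's Theorem A).  Consumed BY NAME: `prodPeriod` / `powPeriod`, `finrank_homRat_prod_right`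
(`ComplexTorusProductHomRank`), `finrank_homRat_powPeriod_right` / `finrank_homRat_powers_right`
(`ComplexTorusPoincareCompleteReducibilityUniqueness`), `IsAbelianVariety.prod` (`ComplexTorusProduct`),
`IsAbelianVariety.pow` (`ComplexTorusZarhinTrick`), `IsAbelianVariety.sigmaPi`.

## Sources

E. Kani, M. Rosen, *Idempotent relations and factors of Jacobians*, Math. Ann. **284** (1989) 307–327,
Theorem B (paywalled; acquisition request acq-09882), as restated VERBATIM in J. Paulhus, *Decomposing
Jacobians of curves with extra automorphisms*, Acta Arith. **132** (2008), held text
`paper:doi-10-4064-aa132-3-3`, p0002–p0003 (printed pp. 232–233):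

> "Given a subgroup `H` of `G`, one way to create isogeny relations in `ℚ[G]` is to consider relations
> among the idempotents of the form `ε_H = (1/|H|) Σ_{h ∈ H} h`. In particular, this leads to a
> decomposition of `J_X` in terms of Jacobians of quotient curves `X/H`.
> **Theorem 2** (Theorem B, [12]). Given a curve `X`, let `G ≤ Aut(X)` be a finite group such that
> `G = H_1 ∪ ⋯ ∪ H_m` where the subgroups `H_i` satisfy `H_i ∩ H_j = 1_G` if `i ≠ j`. Then we have the
> following isogeny relation: `J_X^{m-1} × J_{X/G}^{g} ∼ J_{X/H_1}^{h_1} × ⋯ × J_{X/H_m}^{h_m}` where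
> `g = |G|` and `h_i = |H_i|` and `J^r` means the product of `J` with itself `r` times."

and p. 232: "Idempotent relations in `ℚ[G]` lead via the map `e` to idempotent relations in `End⁰(J_X)`".

## What is proved, and in which form

TORUS LEVEL, for an abelian variety `X = E/Φ(ℤ^ι)` (a complex torus with a Riemann form), a finite group
`G` and ANY monoid homomorphism `ρ : G → End_ℚ(X)` (for `G ≤ Aut(X)` this is the inclusion; `e|_G` in the
quotation), with the Jacobians `J_{X/H}` of the printed statement REPLACED BY THE IMAGES
`X^{ε_H} = ε_H(X)` (`idemPeriod Φ ε_H`).  This is the form Theorem A produces from the idempotent relation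
`Σ_i |H_i| ε_{H_i} = (m - 1)·1 + |G|·ε_G`; that for the Jacobian of a curve with `G ≤ Aut(X)` one has
`ε_H(J_X) ∼ J_{X/H}` is a separate statement about curves which is NOT asserted here.
(`-- TODO(general form): J_{X/H} ∼ ε_H J_X for Jacobians of curves, once Jacobians are in the tree.`)

The proof does not go through Theorem A's index bookkeeping: both sides are abelian varieties and the
`ℚ`-character `χ_S` of the relation gives equal Hom-counts
`(m-1)·dim Hom_ℚ(S, X) + |G|·dim Hom_ℚ(S, X^{ε_G}) = Σ_i |H_i|·dim Hom_ℚ(S, X^{ε_{H_i}})` from every complex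
torus `S`, so the Hom-count isogeny criterion applies.

## Contents (definitions with bodies: `groupAverage`, `kleinFourSubgroups`, `ratTrace` and the
## abbreviation `subgroupAverage`; theorems; NO named fact)

* §1 `groupAverage ρ` (`ε_G = |G|⁻¹ Σ_g ρ(g)`), `card_smul_groupAverage`, `map_mul_groupAverage`
  (`ρ(g) ε_G = ε_G`), **`isIdempotentElem_groupAverage`**, `coe_groupAverage`; `subgroupAverage ρ H` (`ε_H`),
  `card_smul_subgroupAverage`, `isIdempotentElem_subgroupAverage`;
* §2 the counting identity of a partition of `G` by subgroups, `sum_sum_subgroup_eq_of_partition`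
  (`Σ_i Σ_{h ∈ H_i} f(h) = (m-1)•f(1) + Σ_g f(g)` in any additive commutative monoid);
* §3 **`sum_card_smul_subgroupAverage_eq`** (`Σ_i |H_i|•ε_{H_i} = (m-1)•1 + |G|•ε_G` in `End_ℚ(X)`),
  `finrank_homRat_kaniRosenB_eq` (the Hom-counts, for every torus `S`);
* §4 **Theorem B** `IsAbelianVariety.isIsogenous_kaniRosenB'` (orders `g`, `h_i` as parameters) and
  `IsAbelianVariety.isIsogenous_kaniRosenB`; validation on the Klein four-group: `kleinFourSubgroups`
  (`⟨a⟩, ⟨b⟩, ⟨ab⟩`), `kleinFourSubgroups_cover` / `_disjoint`, and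
  **`IsAbelianVariety.isIsogenous_kaniRosenB_kleinFour`** (`X² × (X^{ε_{V₄}})⁴ ∼ ∏_{i<3} (X^{ε_{H_i}})²`);
* §5 **Theorem A with multiplicities** `IsAbelianVariety.isIsogenous_powers_idemPeriod_of_sum_smul_eq`
  (`Σ_i a_i ε_i = Σ_j b_j ε'_j ⟹ ∏_i (X^{ε_i})^{a_i} ∼ ∏_j (X^{ε'_j})^{b_j}`), and `X^1 ∼ X`
  (`IsAbelianVariety.isIsogenous_idemPeriod_one`);
* §6 complements (add-only append): the rational trace `ratTrace` with `ratTrace_eq_subRank`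
  (`Tr_r(ε) = rk Λ(X^ε)`, Cor. 2.4.28), the DIMENSION COUNT of Theorem B `subRank_kaniRosenB_eq` /
  `finrank_kaniRosenB_eq` (`(m-1) dim X + |G| dim X^{ε_G} = Σ_i |H_i| dim X^{ε_{H_i}}`), and conjugate
  idempotents: `mulLeft_mul`, `homCharacter_mul_comm` (`χ_Y(ab) = χ_Y(ba)`), `homCharacter_conj`,
  **`IsAbelianVariety.isIsogenous_idemPeriod_conj`** (`X^{uεu⁻¹} ∼ X^ε`).

## References

* [KaniRosen1989] E. Kani, M. Rosen, *Idempotent relations and factors of Jacobians*, Math. Ann. 284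
  (1989) 307–327, Theorems A and B (paywalled; acq-09882).
* [Paulhus2008] J. Paulhus, *Decomposing Jacobians of curves with extra automorphisms*, Acta Arith. 132
  (2008) 231–244, pp. 232–233, Theorems 1 and 2 (restatements of Kani–Rosen A and B; held
  `paper:doi-10-4064-aa132-3-3`).
* [Lange2023AbelianVarietiesComplex] H. Lange, *Abelian Varieties over the Complex Numbers*, Grundlehren
  Text Edition, Springer (2023), §2.4.5 Exercise (22) (chunk p0128), §2.4.3 (`X^ε`, p0121), §2.4.4
  Cor. 2.4.26 (p0124).
-/

noncomputable section

open Module Function Matrix Complex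
open scoped Manifold

namespace Literature.Geometry.Kaehler

namespace ComplexTorus

universe u v

/-! ### §1 The averaging idempotents `ε_G = |G|⁻¹ Σ_g ρ(g)` and `ε_H` of a finite group in `End_ℚ(X)` -/

section GroupAverage

variable {ι : Type*} [Fintype ι] [DecidableEq ι] {E : Type*} [NormedAddCommGroup E] [NormedSpace ℂ E]
  {Φ : (ι → ℝ) ≃L[ℝ] E} {G : Type*} [Group G] [Fintype G] (ρ : G →* endAlgRat Φ)

/-- **The averaging idempotent `ε_G = (1/|G|) Σ_{g ∈ G} ρ(g) ∈ End_ℚ(X)`** of a finite group `G` mapped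
into `End_ℚ(X)` by a monoid homomorphism `ρ` (e.g. a finite group of automorphisms of `X`; the image of
the idempotent `ε_G` of `ℚ[G]` under `e : ℚ[G] → End⁰`). [cite: Paulhus2008, p. 232 (`ε_H = (1/|H|) Σ_{h ∈ H} h`)] [cite: KaniRosen1989, Theorem B] -/
def groupAverage : endAlgRat Φ :=
  (Fintype.card G : ℚ)⁻¹ • ∑ g, ρ g

/-- `|G| • ε_G = Σ_g ρ(g)`. [cite: Paulhus2008, p. 232] -/
theorem card_smul_groupAverage : (Fintype.card G : ℚ) • groupAverage ρ = ∑ g, ρ g := by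
  rw [groupAverage, smul_smul, mul_inv_cancel₀ (Nat.cast_ne_zero.2 Fintype.card_ne_zero), one_smul]

/-- `ρ(g) (Σ_k ρ(k)) = Σ_k ρ(k)` (reindex `k ↦ g k`). [cite: Paulhus2008, p. 232] -/
theorem map_mul_sum_map (g : G) : ρ g * ∑ k, ρ k = ∑ k, ρ k := by
  rw [Finset.mul_sum]
  exact Fintype.sum_equiv (Equiv.mulLeft g) _ _ fun k ↦ by rw [← map_mul]; rfl

/-- **`ρ(g) ε_G = ε_G`.** [cite: Paulhus2008, p. 232] [cite: KaniRosen1989, Theorem B] -/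
theorem map_mul_groupAverage (g : G) : ρ g * groupAverage ρ = groupAverage ρ := by
  rw [groupAverage, mul_smul_comm, map_mul_sum_map]

/-- **`ε_G` is an idempotent of `End_ℚ(X)`** (`ε_G² = |G|⁻¹ Σ_g ρ(g) ε_G = |G|⁻¹ Σ_g ε_G = ε_G`).
[cite: Paulhus2008, p. 232 ("relations on the idempotents of the form `ε_H`")] [cite: KaniRosen1989, Theorem B] -/
theorem isIdempotentElem_groupAverage : IsIdempotentElem (groupAverage ρ) := by
  have h : (∑ g, ρ g) * groupAverage ρ = (Fintype.card G : ℚ) • groupAverage ρ := by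
    rw [Finset.sum_mul, Finset.sum_congr rfl fun g _ ↦ map_mul_groupAverage ρ g, Finset.sum_const,
      Finset.card_univ, ← Nat.cast_smul_eq_nsmul ℚ]
  rw [IsIdempotentElem]
  change ((Fintype.card G : ℚ)⁻¹ • ∑ g, ρ g) * groupAverage ρ = groupAverage ρ
  rw [smul_mul_assoc, h, smul_smul, inv_mul_cancel₀ (Nat.cast_ne_zero.2 Fintype.card_ne_zero), one_smul]

/-- The underlying rational matrix of `ε_G`. [cite: Paulhus2008, p. 232] -/
theorem coe_groupAverage :
    (groupAverage ρ : Matrix ι ι ℚ) = (Fintype.card G : ℚ)⁻¹ • ∑ g, (ρ g : Matrix ι ι ℚ) := by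
  rw [groupAverage, Subalgebra.coe_smul]
  congr 1
  exact map_sum (endAlgRat Φ).val _ _

variable (H : Subgroup G) [Fintype H]

/-- **`ε_H = (1/|H|) Σ_{h ∈ H} ρ(h)`** for a subgroup `H ≤ G`: the averaging idempotent of `ρ|_H`.
[cite: Paulhus2008, p. 232] [cite: KaniRosen1989, Theorem B] -/
abbrev subgroupAverage : endAlgRat Φ :=
  groupAverage (ρ.comp H.subtype)

omit [Fintype G] in
/-- `|H| • ε_H = Σ_{h ∈ H} ρ(h)`. [cite: Paulhus2008, p. 232] -/
theorem card_smul_subgroupAverage : (Fintype.card H : ℚ) • subgroupAverage ρ H = ∑ h : H, ρ h :=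
  card_smul_groupAverage _

omit [Fintype G] in
/-- `ε_H` is idempotent. [cite: Paulhus2008, p. 232] [cite: KaniRosen1989, Theorem B] -/
theorem isIdempotentElem_subgroupAverage : IsIdempotentElem (subgroupAverage ρ H) :=
  isIdempotentElem_groupAverage _

end GroupAverage

/-! ### §2 The partition identity `Σ_i Σ_{h ∈ H_i} f(h) = (m-1) f(1) + Σ_{g ∈ G} f(g)` -/

section Partition

variable {G : Type*} [Group G] [Fintype G] [DecidableEq G] {m : ℕ} (H : Fin m → Subgroup G)
  [∀ i, Fintype (H i)] [∀ i, DecidablePred (· ∈ H i)]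
  {M : Type*} [AddCommMonoid M]

omit [Fintype G] [DecidableEq G] [∀ i, Fintype (H i)] [∀ i, DecidablePred (· ∈ H i)] in
/-- If subgroups `H_1, …, H_m` cover `G` then `m ≥ 1`. [folklore] -/
private theorem pos_of_cover (hcover : ∀ g, ∃ i, g ∈ H i) : 0 < m := by
  obtain ⟨i, -⟩ := hcover 1
  exact Fin.pos i

omit [Fintype G] [DecidableEq G] [∀ i, Fintype (H i)] in
/-- For `g ≠ 1`, exactly one `H_i` contains `g`. [folklore] -/
private theorem card_filter_mem_eq_one (hcover : ∀ g, ∃ i, g ∈ H i)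
    (hdisj : ∀ i j, i ≠ j → ∀ g, g ∈ H i → g ∈ H j → g = 1) {g : G} (hg : g ≠ 1) :
    (Finset.univ.filter fun i ↦ g ∈ H i).card = 1 := by
  obtain ⟨i, hi⟩ := hcover g
  refine Finset.card_eq_one.2 ⟨i, Finset.eq_singleton_iff_unique_mem.2 ⟨by simpa using hi, fun j hj ↦ ?_⟩⟩
  by_contra hji
  exact hg (hdisj j i hji g (by simpa using hj) hi)

omit [Fintype G] [DecidableEq G] [∀ i, Fintype (H i)] in
/-- Every `H_i` contains `1`: `#{i | 1 ∈ H_i} = m`. [folklore] -/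
private theorem card_filter_one_mem : (Finset.univ.filter fun i ↦ (1 : G) ∈ H i).card = m := by
  rw [Finset.filter_true_of_mem fun i _ ↦ (H i).one_mem, Finset.card_univ, Fintype.card_fin]

/-- **The counting identity of a partition of `G` by subgroups**: if `G = H_1 ∪ ⋯ ∪ H_m` with
`H_i ∩ H_j = {1}` for `i ≠ j`, then `Σ_i Σ_{h ∈ H_i} f(h) = (m - 1) • f(1) + Σ_{g ∈ G} f(g)` for any
`f : G → M` (each `g ≠ 1` is counted once, `1` is counted `m` times) — the identity
`Σ_i |H_i| ε_{H_i} = (m-1) + |G| ε_G` of `ℚ[G]` behind Theorem B.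
[cite: KaniRosen1989, Theorem B] [cite: Paulhus2008, p. 233 Theorem 2] -/
theorem sum_sum_subgroup_eq_of_partition (hcover : ∀ g, ∃ i, g ∈ H i)
    (hdisj : ∀ i j, i ≠ j → ∀ g, g ∈ H i → g ∈ H j → g = 1) (f : G → M) :
    ∑ i, ∑ h : H i, f h = (m - 1) • f 1 + ∑ g, f g := by
  -- `Σ_{h ∈ H_i} f h = Σ_g [g ∈ H_i] f g`
  have h1 : ∀ i, ∑ h : H i, f h = ∑ g, if g ∈ H i then f g else 0 := fun i ↦ by
    rw [← Finset.sum_subtype (p := (· ∈ H i)) (Finset.univ.filter fun g ↦ g ∈ H i) (fun x ↦ by simp) f,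
      Finset.sum_filter]
  simp_rw [h1]
  rw [Finset.sum_comm]
  -- `Σ_i [g ∈ H_i] f g = #{i | g ∈ H_i} • f g`
  have h2 : ∀ g, (∑ i, if g ∈ H i then f g else 0) = (Finset.univ.filter fun i ↦ g ∈ H i).card • f g :=
    fun g ↦ by rw [← Finset.sum_filter, Finset.sum_const]
  simp_rw [h2]
  -- split off `g = 1`
  rw [← Finset.add_sum_erase _ _ (Finset.mem_univ (1 : G)), ← Finset.add_sum_erase _ f (Finset.mem_univ (1 : G)),
    card_filter_one_mem H, ← add_assoc]
  congr 1
  · have hm : 1 ≤ m := pos_of_cover H hcover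
    rw [← succ_nsmul, Nat.sub_add_cancel hm]
  · exact Finset.sum_congr rfl fun g hg ↦ by
      rw [card_filter_mem_eq_one H hcover hdisj (Finset.ne_of_mem_erase hg), one_smul]

end Partition

/-! ### §3 The relation `Σ_i |H_i| ε_{H_i} = (m - 1)·1 + |G| ε_G` in `End_ℚ(X)` and its Hom-counts -/

section Relation

variable {ι : Type*} [Fintype ι] [DecidableEq ι] {E : Type*} [NormedAddCommGroup E] [NormedSpace ℂ E]
  (Φ : (ι → ℝ) ≃L[ℝ] E) {G : Type*} [Group G] [Fintype G] [DecidableEq G] (ρ : G →* endAlgRat Φ)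
  {m : ℕ} (H : Fin m → Subgroup G) [∀ i, Fintype (H i)] [∀ i, DecidablePred (· ∈ H i)]

/-- **The idempotent relation of Theorem B in `End_ℚ(X)`**: for subgroups `H_1, …, H_m` covering `G`
with pairwise intersections `{1}`, `Σ_i |H_i| • ε_{H_i} = (m - 1) • 1 + |G| • ε_G` (the image under
`ρ` of the identity `Σ_i Σ_{h ∈ H_i} h = (m-1)·1 + Σ_{g ∈ G} g` of `ℚ[G]`).
[cite: KaniRosen1989, Theorem B] [cite: Paulhus2008, pp. 232–233 (Theorem 2 and "Idempotent relations in `ℚ[G]` lead via the map `e` to idempotent relations in `End⁰`")] -/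
theorem sum_card_smul_subgroupAverage_eq (hcover : ∀ g, ∃ i, g ∈ H i)
    (hdisj : ∀ i j, i ≠ j → ∀ g, g ∈ H i → g ∈ H j → g = 1) :
    ∑ i, (Fintype.card (H i) : ℚ) • subgroupAverage ρ (H i) =
      ((m - 1 : ℕ) : ℚ) • (1 : endAlgRat Φ) + (Fintype.card G : ℚ) • groupAverage ρ := by
  simp_rw [card_smul_subgroupAverage, card_smul_groupAverage]
  have h := sum_sum_subgroup_eq_of_partition H hcover hdisj (fun g ↦ ρ g)
  rw [map_one] at h
  rw [Nat.cast_smul_eq_nsmul]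
  exact h

variable {ι₀ : Type*} [Fintype ι₀] [DecidableEq ι₀] {E₀ : Type*} [NormedAddCommGroup E₀] [NormedSpace ℂ E₀]

/-- **The Hom-counts of Theorem B**: for EVERY complex torus `S`,
`(m-1)·dim_ℚ Hom_ℚ(S, X) + |G|·dim_ℚ Hom_ℚ(S, X^{ε_G}) = Σ_i |H_i|·dim_ℚ Hom_ℚ(S, X^{ε_{H_i}})` — the
`ℚ`-character `χ_S` applied to the relation (`χ_S(ε) = dim_ℚ Hom_ℚ(S, X^ε)`, `χ_S(1) = dim_ℚ Hom_ℚ(S, X)`).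
[cite: KaniRosen1989, Theorems A and B] [cite: Paulhus2008, pp. 232–233] -/
theorem finrank_homRat_kaniRosenB_eq (hcover : ∀ g, ∃ i, g ∈ H i)
    (hdisj : ∀ i j, i ≠ j → ∀ g, g ∈ H i → g ∈ H j → g = 1) (S : (ι₀ → ℝ) ≃L[ℝ] E₀) :
    (m - 1) * finrank ℚ (homRat S Φ) +
        Fintype.card G * finrank ℚ (homRat S (idemPeriod Φ (groupAverage ρ))) =
      ∑ i, Fintype.card (H i) * finrank ℚ (homRat S (idemPeriod Φ (subgroupAverage ρ (H i)))) := by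
  have h := congrArg (homCharacter S Φ) (sum_card_smul_subgroupAverage_eq Φ ρ H hcover hdisj)
  rw [map_sum, map_add, map_smul, map_smul, homCharacter_one,
    homCharacter_eq_finrank S Φ (isIdempotentElem_groupAverage ρ)] at h
  simp only [map_smul, smul_eq_mul] at h
  have h' : ∀ i, homCharacter S Φ (subgroupAverage ρ (H i)) =
      finrank ℚ (homRat S (idemPeriod Φ (subgroupAverage ρ (H i)))) :=
    fun i ↦ homCharacter_eq_finrank S Φ (isIdempotentElem_subgroupAverage ρ (H i))
  simp only [h'] at h
  exact_mod_cast h.symm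

end Relation

/-! ### §4 Theorem B: `X^{m-1} × (X^{ε_G})^{|G|} ∼ ∏_i (X^{ε_{H_i}})^{|H_i|}` -/

section TheoremB

variable {ι : Type*} [Fintype ι] [DecidableEq ι] {E : Type u} [NormedAddCommGroup E] [NormedSpace ℂ E]
  (Φ : (ι → ℝ) ≃L[ℝ] E) {G : Type*} [Group G] [Fintype G] [DecidableEq G] (ρ : G →* endAlgRat Φ)
  {m : ℕ} (H : Fin m → Subgroup G) [∀ i, Fintype (H i)] [∀ i, DecidablePred (· ∈ H i)]

/-- **Kani–Rosen, Theorem B, at torus level (numerical form).**  Let `X = E/Φ(ℤ^ι)` be an abelian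
variety, `G` a finite group of order `g` with a homomorphism `ρ : G → End_ℚ(X)` of monoids (e.g. a finite
group of automorphisms of `X`), and `H_1, …, H_m ≤ G` subgroups of orders `h_i` with `G = H_1 ∪ ⋯ ∪ H_m` and
`H_i ∩ H_j = {1}` for `i ≠ j`.  Then, with `X^{ε}` the image of the idempotent `ε` (`idemPeriod`),
`X^{m-1} × (X^{ε_G})^{g} ∼ (X^{ε_{H_1}})^{h_1} × ⋯ × (X^{ε_{H_m}})^{h_m}`.
This is the printed Theorem B with the Jacobians `J_{X/H}` of the quotient curves replaced by the images
`X^{ε_H} = ε_H(X)` — the form in which Theorem A delivers it (for the Jacobian of a curve with `G ≤ Aut`,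
`J_{X/H} ∼ ε_H(J_X)` is a separate fact about curves, not asserted here).  Proof: both sides are abelian
varieties with the same Hom-counts from every complex torus (§3), hence isogenous (Hom-count criterion).
[cite: KaniRosen1989, Theorem B] [cite: Paulhus2008, p. 233 Theorem 2] [cite: Lange2023AbelianVarietiesComplex, §2.4.5 Exercise (22), p0128] -/
theorem IsAbelianVariety.isIsogenous_kaniRosenB' (hX : IsAbelianVariety Φ) (hcover : ∀ g, ∃ i, g ∈ H i)
    (hdisj : ∀ i j, i ≠ j → ∀ g, g ∈ H i → g ∈ H j → g = 1) {g : ℕ} {h : Fin m → ℕ}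
    (hg : Fintype.card G = g) (hh : ∀ i, Fintype.card (H i) = h i) :
    IsIsogenous
      (prodPeriod (powPeriod Φ (m - 1)) (powPeriod (idemPeriod Φ (groupAverage ρ)) g))
      (sigmaPiPeriod fun i ↦ powPeriod (idemPeriod Φ (subgroupAverage ρ (H i))) (h i)) := by
  have h₁ : IsAbelianVariety
      (prodPeriod (powPeriod Φ (m - 1)) (powPeriod (idemPeriod Φ (groupAverage ρ)) g)) :=
    (hX.pow _).prod ((isAbelianVariety_idemPeriod Φ hX _).pow _)
  have h₂ : IsAbelianVariety
      (sigmaPiPeriod fun i ↦ powPeriod (idemPeriod Φ (subgroupAverage ρ (H i))) (h i)) :=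
    IsAbelianVariety.sigmaPi fun i ↦ (isAbelianVariety_idemPeriod Φ hX _).pow _
  refine h₁.isIsogenous_of_forall_finrank_homRat_eq h₂ fun k E₀ _ _ S _ ↦ ?_
  rw [finrank_homRat_prod_right, finrank_homRat_powPeriod_right, finrank_homRat_powPeriod_right,
    finrank_homRat_powers_right, ← hg]
  simp_rw [← hh]
  exact finrank_homRat_kaniRosenB_eq Φ ρ H hcover hdisj S

/-- **Kani–Rosen, Theorem B, at torus level**: `X^{m-1} × (X^{ε_G})^{|G|} ∼ ∏_i (X^{ε_{H_i}})^{|H_i|}` for an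
abelian variety `X`, a finite group `G → End_ℚ(X)` and subgroups `H_1, …, H_m` covering `G` with pairwise
intersections `{1}` (see `IsAbelianVariety.isIsogenous_kaniRosenB'` for the discussion of the form).
[cite: KaniRosen1989, Theorem B] [cite: Paulhus2008, p. 233 Theorem 2] -/
theorem IsAbelianVariety.isIsogenous_kaniRosenB (hX : IsAbelianVariety Φ) (hcover : ∀ g, ∃ i, g ∈ H i)
    (hdisj : ∀ i j, i ≠ j → ∀ g, g ∈ H i → g ∈ H j → g = 1) :
    IsIsogenous
      (prodPeriod (powPeriod Φ (m - 1)) (powPeriod (idemPeriod Φ (groupAverage ρ)) (Fintype.card G)))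
      (sigmaPiPeriod fun i ↦ powPeriod (idemPeriod Φ (subgroupAverage ρ (H i))) (Fintype.card (H i))) :=
  hX.isIsogenous_kaniRosenB' Φ ρ H hcover hdisj rfl fun _ ↦ rfl

end TheoremB

/-! #### Validation: the Klein four-group `V₄ = ⟨a⟩ ∪ ⟨b⟩ ∪ ⟨ab⟩` gives `X² × (X^{ε_G})⁴ ∼ ∏ (X^{ε_{H_i}})²` -/

section KleinFour

variable {G : Type*} [Group G]

/-- In a group of exponent `2`, `⟨x⟩ = {1, x}`. [folklore] -/
private theorem mem_zpowers_iff_of_isKleinFour [IsKleinFour G] (x g : G) :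
    g ∈ Subgroup.zpowers x ↔ g = 1 ∨ g = x := by
  constructor
  · rintro ⟨k, rfl⟩
    rcases Int.even_or_odd k with ⟨j, rfl⟩ | ⟨j, rfl⟩
    · left
      change x ^ (j + j) = 1
      rw [_root_.zpow_add, IsKleinFour.mul_self]
    · right
      change x ^ (2 * j + 1) = x
      rw [_root_.zpow_add, zpow_one, two_mul, _root_.zpow_add, IsKleinFour.mul_self, one_mul]
  · rintro (rfl | rfl)
    · exact one_mem _
    · exact Subgroup.mem_zpowers _

/-- The three cyclic subgroups `⟨x⟩, ⟨y⟩, ⟨xy⟩` of a Klein four-group generated by `x ≠ y` (both `≠ 1`).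
[cite: Paulhus2008, p. 233 (partitions `G = H_1 ∪ ⋯ ∪ H_m` by subgroups)] -/
def kleinFourSubgroups (x y : G) : Fin 3 → Subgroup G :=
  ![Subgroup.zpowers x, Subgroup.zpowers y, Subgroup.zpowers (x * y)]

/-- **`V₄ = ⟨x⟩ ∪ ⟨y⟩ ∪ ⟨xy⟩`.** [cite: Paulhus2008, p. 233 Theorem 2 (hypothesis `G = H_1 ∪ ⋯ ∪ H_m`)] -/
theorem kleinFourSubgroups_cover [IsKleinFour G] {x y : G} (hx : x ≠ 1) (hy : y ≠ 1) (hxy : x ≠ y)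
    (g : G) : ∃ i, g ∈ kleinFourSubgroups x y i := by
  by_cases h1 : g = 1
  · exact ⟨0, h1 ▸ one_mem _⟩
  by_cases h2 : g = x
  · exact ⟨0, h2 ▸ Subgroup.mem_zpowers x⟩
  by_cases h3 : g = y
  · exact ⟨1, h3 ▸ Subgroup.mem_zpowers y⟩
  exact ⟨2, (IsKleinFour.eq_mul_of_ne_all hx hy hxy h1 h2 h3) ▸ Subgroup.mem_zpowers (x * y)⟩

/-- **The three subgroups meet pairwise in `{1}`.** [cite: Paulhus2008, p. 233 Theorem 2 (hypothesis `H_i ∩ H_j = 1_G`)] -/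
theorem kleinFourSubgroups_disjoint [IsKleinFour G] {x y : G} (hx : x ≠ 1) (hy : y ≠ 1) (hxy : x ≠ y) :
    ∀ i j, i ≠ j → ∀ g, g ∈ kleinFourSubgroups x y i → g ∈ kleinFourSubgroups x y j → g = 1 := by
  have hxxy : x ≠ x * y := fun h ↦ hy (mul_eq_left.1 h.symm)
  have hyxy : y ≠ x * y := fun h ↦ hx (mul_eq_right.1 h.symm)
  intro i j hij g hi hj
  fin_cases i <;> fin_cases j <;>
    simp only [kleinFourSubgroups, Fin.zero_eta, Fin.mk_one, Fin.reduceFinMk, Matrix.cons_val_zero,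
      Matrix.cons_val_one, Matrix.cons_val, mem_zpowers_iff_of_isKleinFour] at hi hj hij <;>
    first
    | exact absurd rfl hij
    | rcases hi with rfl | rfl <;> rcases hj with h | h <;> first
      | rfl
      | exact h
      | exact absurd h hxy
      | exact absurd h.symm hxy
      | exact absurd h hxxy
      | exact absurd h.symm hxxy
      | exact absurd h hyxy
      | exact absurd h.symm hyxy

variable [Fintype G] [DecidableEq G] {ι : Type*} [Fintype ι] [DecidableEq ι] {E : Type u}
  [NormedAddCommGroup E] [NormedSpace ℂ E] (Φ : (ι → ℝ) ≃L[ℝ] E) (ρ : G →* endAlgRat Φ)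

open scoped Classical in
/-- **Theorem B for the Klein four-group** `V₄ = {1, a, b, ab} → End_ℚ(X)` (any homomorphism of
monoids, e.g. `V₄ ≤ Aut X`), partitioned by `⟨a⟩, ⟨b⟩, ⟨ab⟩`:
`X² × (X^{ε_{V₄}})⁴ ∼ (X^{ε_{⟨a⟩}})² × (X^{ε_{⟨b⟩}})² × (X^{ε_{⟨ab⟩}})²` — the classical decomposition
`J_X² × J_{X/G}⁴ ∼ J²_{X/⟨a⟩} × J²_{X/⟨b⟩} × J²_{X/⟨ab⟩}` in its torus-level form.
[cite: KaniRosen1989, Theorem B] [cite: Paulhus2008, p. 233 Theorem 2] -/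
theorem IsAbelianVariety.isIsogenous_kaniRosenB_kleinFour [IsKleinFour G] (hX : IsAbelianVariety Φ)
    {x y : G} (hx : x ≠ 1) (hy : y ≠ 1) (hxy : x ≠ y) :
    IsIsogenous (prodPeriod (powPeriod Φ 2) (powPeriod (idemPeriod Φ (groupAverage ρ)) 4))
      (sigmaPiPeriod fun i : Fin 3 ↦
        powPeriod (idemPeriod Φ (subgroupAverage ρ (kleinFourSubgroups x y i))) 2) := by
  have hord : ∀ z : G, z ≠ 1 → orderOf z = 2 := fun z hz ↦
    orderOf_eq_prime (by rw [pow_two, IsKleinFour.mul_self]) hz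
  have hxy' : x * y ≠ 1 := fun h ↦ hxy (by
    rw [← IsKleinFour.inv_eq_self y]
    exact eq_inv_of_mul_eq_one_left h)
  refine hX.isIsogenous_kaniRosenB' Φ ρ (kleinFourSubgroups x y) (kleinFourSubgroups_cover hx hy hxy)
    (kleinFourSubgroups_disjoint hx hy hxy) IsKleinFour.card_four' fun i ↦ ?_
  rw [Fintype.card_eq_nat_card]
  fin_cases i
  · show Nat.card (Subgroup.zpowers x) = 2
    rw [Nat.card_zpowers, hord x hx]
  · show Nat.card (Subgroup.zpowers y) = 2
    rw [Nat.card_zpowers, hord y hy]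
  · show Nat.card (Subgroup.zpowers (x * y)) = 2
    rw [Nat.card_zpowers, hord (x * y) hxy']

end KleinFour


/-! ### §5 Theorem A with multiplicities, and `X^1 ∼ X` -/

section Multiplicities

variable {ι : Type*} [Fintype ι] [DecidableEq ι] {E : Type u} [NormedAddCommGroup E] [NormedSpace ℂ E]
  (Φ : (ι → ℝ) ≃L[ℝ] E) {κ κ' : Type v} [Fintype κ] [Fintype κ'] [DecidableEq κ] [DecidableEq κ']

/-- **Theorem A with multiplicities.**  For an abelian variety `X` and idempotents `ε_i`, `ε'_j` of
`End_ℚ(X)` with multiplicities `a_i, b_j ∈ ℕ`: if `Σ_i a_i ε_i = Σ_j b_j ε'_j` in `End_ℚ(X)` then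
`∏_i (X^{ε_i})^{a_i} ∼ ∏_j (X^{ε'_j})^{b_j}` (Theorem A for the families with `ε_i` repeated `a_i` times;
here via the Hom-counts `Σ_i a_i χ_S(ε_i) = Σ_j b_j χ_S(ε'_j)`; the relation is stated with the
coefficients in `ℚ ⊆ End_ℚ(X)`).
[cite: KaniRosen1989, Theorem A] [cite: Paulhus2008, p. 232 Theorem 1] [cite: Lange2023AbelianVarietiesComplex, §2.4.5 Exercise (22), p0128] -/
theorem IsAbelianVariety.isIsogenous_powers_idemPeriod_of_sum_smul_eq (hX : IsAbelianVariety Φ)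
    {A : κ → endAlgRat Φ} {A' : κ' → endAlgRat Φ}
    (hA : ∀ i, IsIdempotentElem (A i)) (hA' : ∀ j, IsIdempotentElem (A' j)) {a : κ → ℕ} {b : κ' → ℕ}
    (h : ∑ i, (a i : ℚ) • A i = ∑ j, (b j : ℚ) • A' j) :
    IsIsogenous (sigmaPiPeriod fun i ↦ powPeriod (idemPeriod Φ (A i)) (a i))
      (sigmaPiPeriod fun j ↦ powPeriod (idemPeriod Φ (A' j)) (b j)) := by
  have h₁ : IsAbelianVariety (sigmaPiPeriod fun i ↦ powPeriod (idemPeriod Φ (A i)) (a i)) :=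
    IsAbelianVariety.sigmaPi fun i ↦ (isAbelianVariety_idemPeriod Φ hX _).pow _
  have h₂ : IsAbelianVariety (sigmaPiPeriod fun j ↦ powPeriod (idemPeriod Φ (A' j)) (b j)) :=
    IsAbelianVariety.sigmaPi fun j ↦ (isAbelianVariety_idemPeriod Φ hX _).pow _
  refine h₁.isIsogenous_of_forall_finrank_homRat_eq h₂ fun k E₀ _ _ S _ ↦ ?_
  rw [finrank_homRat_powers_right, finrank_homRat_powers_right]
  have hc := congrArg (homCharacter S Φ) h
  rw [map_sum, map_sum] at hc
  simp only [map_smul, smul_eq_mul] at hc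
  simp only [homCharacter_eq_finrank S Φ (hA _), homCharacter_eq_finrank S Φ (hA' _)] at hc
  exact_mod_cast hc

/-- **`X^1 ∼ X`** for an abelian variety `X`: the torus of the idempotent `1` (on the full lattice
subspace `Im 1 = Λ ⊗ ℝ`) is isogenous to `X` (equal Hom-counts: `χ_S(1) = dim_ℚ Hom_ℚ(S, X)`).
[cite: Lange2023AbelianVarietiesComplex, §2.4.3 (Thm. 2.4.19: `ε = 1` corresponds to `X`), p0121] -/
theorem IsAbelianVariety.isIsogenous_idemPeriod_one (hX : IsAbelianVariety Φ) :
    IsIsogenous (idemPeriod Φ (1 : endAlgRat Φ)) Φ :=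
  (isAbelianVariety_idemPeriod Φ hX 1).isIsogenous_of_forall_finrank_homRat_eq hX fun _ _ _ _ S _ ↦ by
    have h := homCharacter_eq_finrank S Φ (IsIdempotentElem.one : IsIdempotentElem (1 : endAlgRat Φ))
    rw [homCharacter_one] at h
    exact_mod_cast h.symm

end Multiplicities

/-! ### §6 Complements: the dimension count of Theorem B, and conjugate idempotents
(add-only append, seat `lit-hodgefound-p10` generation 5) -/

section DimensionCount

variable {ι : Type*} [Fintype ι] [DecidableEq ι] {E : Type*} [NormedAddCommGroup E] [NormedSpace ℂ E]
  (Φ : (ι → ℝ) ≃L[ℝ] E) {G : Type*} [Group G] [Fintype G] [DecidableEq G] (ρ : G →* endAlgRat Φ)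
  {m : ℕ} (H : Fin m → Subgroup G) [∀ i, Fintype (H i)] [∀ i, DecidablePred (· ∈ H i)]

/-- The rational trace on `End_ℚ(X) ⊆ M_ι(ℚ)` as a `ℚ`-linear form (`Tr_r`). [cite: Lange2023AbelianVarietiesComplex, §2.4.4 Cor. 2.4.28 (`Tr_r`, `Tr_a`), p0124] -/
def ratTrace : endAlgRat Φ →ₗ[ℚ] ℚ :=
  (Matrix.traceLinearMap ι ℚ ℚ) ∘ₗ (endAlgRat Φ).val.toLinearMap

/-- `ratTrace Φ a = tr(a)`. [cite: Lange2023AbelianVarietiesComplex, §2.4.4 Cor. 2.4.28, p0124] -/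
@[simp] theorem ratTrace_apply (A : endAlgRat Φ) : ratTrace Φ A = (A : Matrix ι ι ℚ).trace := rfl

/-- **`Tr_r(ε) = rk Λ(X^ε)`** (`= 2 dim X^ε`, Cor. 2.4.28) for an idempotent `ε ∈ End_ℚ(X)`, with the rank
of the lattice of the sub-torus `X^ε` (`subRank`). [cite: Lange2023AbelianVarietiesComplex, §2.4.4 Cor. 2.4.28 (`dim X^ε = Tr(ε)`), p0124] -/
theorem ratTrace_eq_subRank {A : endAlgRat Φ} (hA : IsIdempotentElem A) :
    ratTrace Φ A = subRank (idemSubspace (A : Matrix ι ι ℚ)) := by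
  have hA' : (A : Matrix ι ι ℚ) * (A : Matrix ι ι ℚ) = A := congrArg Subtype.val hA
  have h := trace_eq_finrank_idemSubspace hA'
  rw [finrank_eq_subRank (isLatticeSubspace_idemSubspace _)] at h
  rw [ratTrace_apply]
  exact_mod_cast h

/-- **The dimension count of Theorem B** (Kani–Rosen's relation read through `Tr_r`, i.e. the
Riemann–Hurwitz-type identity behind `(m-1) g_X + |G| g_{X/G} = Σ_i |H_i| g_{X/H_i}`): in lattice ranks
(`= 2 ×` complex dimensions), `(m-1)·rk Λ + |G|·rk Λ(X^{ε_G}) = Σ_i |H_i|·rk Λ(X^{ε_{H_i}})`.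
[cite: KaniRosen1989, Theorem B] [cite: Paulhus2008, p. 233 Theorem 2] [cite: Lange2023AbelianVarietiesComplex, §2.4.4 Cor. 2.4.28, p0124] -/
theorem subRank_kaniRosenB_eq (hcover : ∀ g, ∃ i, g ∈ H i)
    (hdisj : ∀ i j, i ≠ j → ∀ g, g ∈ H i → g ∈ H j → g = 1) :
    (m - 1) * Fintype.card ι + Fintype.card G * subRank (idemSubspace (groupAverage ρ : Matrix ι ι ℚ)) =
      ∑ i, Fintype.card (H i) * subRank (idemSubspace (subgroupAverage ρ (H i) : Matrix ι ι ℚ)) := by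
  have h := congrArg (ratTrace Φ) (sum_card_smul_subgroupAverage_eq Φ ρ H hcover hdisj)
  rw [map_sum, map_add, map_smul, map_smul, ratTrace_eq_subRank Φ (isIdempotentElem_groupAverage ρ)] at h
  simp only [map_smul, smul_eq_mul, ratTrace_eq_subRank Φ (isIdempotentElem_subgroupAverage ρ _)] at h
  rw [ratTrace_apply, Subalgebra.coe_one, Matrix.trace_one] at h
  exact_mod_cast h.symm

/-- The same in complex dimensions: `(m-1)·dim X + |G|·dim X^{ε_G} = Σ_i |H_i|·dim X^{ε_{H_i}}` — for the
Jacobian of a curve with `G ≤ Aut` (where `dim ε_H(J_X) = g_{X/H}`) this is the genus identity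
accompanying Theorem B. [cite: KaniRosen1989, Theorem B] [cite: Lange2023AbelianVarietiesComplex, §2.4.4 Cor. 2.4.28, p0124] -/
theorem finrank_kaniRosenB_eq [FiniteDimensional ℂ E] (hcover : ∀ g, ∃ i, g ∈ H i)
    (hdisj : ∀ i j, i ≠ j → ∀ g, g ∈ H i → g ∈ H j → g = 1) :
    (m - 1) * finrank ℂ E +
        Fintype.card G * finrank ℂ (cxSpan Φ (idemSubspace (groupAverage ρ : Matrix ι ι ℚ))) =
      ∑ i, Fintype.card (H i) *
        finrank ℂ (cxSpan Φ (idemSubspace (subgroupAverage ρ (H i) : Matrix ι ι ℚ))) := by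
  have h := subRank_kaniRosenB_eq Φ ρ H hcover hdisj
  have e0 : Fintype.card ι = 2 * finrank ℂ E := card_eq_two_mul_finrank Φ
  have e1 : subRank (idemSubspace (groupAverage ρ : Matrix ι ι ℚ)) =
      2 * finrank ℂ (cxSpan Φ (idemSubspace (groupAverage ρ : Matrix ι ι ℚ))) :=
    subRank_eq_two_mul_finrank Φ (isLatticeSubspace_idemSubspace _)
      (isComplexSubspace_idemSubspace Φ (groupAverage ρ).2)
  have e2 : ∀ i, subRank (idemSubspace (subgroupAverage ρ (H i) : Matrix ι ι ℚ)) =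
      2 * finrank ℂ (cxSpan Φ (idemSubspace (subgroupAverage ρ (H i) : Matrix ι ι ℚ))) := fun i ↦
    subRank_eq_two_mul_finrank Φ (isLatticeSubspace_idemSubspace _)
      (isComplexSubspace_idemSubspace Φ (subgroupAverage ρ (H i)).2)
  rw [e0, e1] at h
  simp only [e2] at h
  have h2 : 2 * ((m - 1) * finrank ℂ E +
      Fintype.card G * finrank ℂ (cxSpan Φ (idemSubspace (groupAverage ρ : Matrix ι ι ℚ)))) =
      2 * ∑ i, Fintype.card (H i) *
        finrank ℂ (cxSpan Φ (idemSubspace (subgroupAverage ρ (H i) : Matrix ι ι ℚ))) := by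
    rw [Finset.mul_sum]
    convert h using 1
    · ring
    · exact Finset.sum_congr rfl fun i _ ↦ by ring
  exact Nat.eq_of_mul_eq_mul_left (by norm_num) h2

end DimensionCount

section Conjugate

variable {ι₀ : Type*} [Fintype ι₀] [DecidableEq ι₀] {E₀ : Type*} [NormedAddCommGroup E₀] [NormedSpace ℂ E₀]
  (Y : (ι₀ → ℝ) ≃L[ℝ] E₀)
  {ι : Type*} [Fintype ι] [DecidableEq ι] {E : Type u} [NormedAddCommGroup E] [NormedSpace ℂ E]
  (Φ : (ι → ℝ) ≃L[ℝ] E)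

/-- `L_{ab} = L_a L_b`: `Hom_ℚ(Y, X)` is a left `End_ℚ(X)`-module. [cite: Lange2023AbelianVarietiesComplex, §1.1.2, p0020 (composition in `Hom_ℚ`)] -/
theorem mulLeft_mul (A B : endAlgRat Φ) : mulLeft Y Φ (A * B) = mulLeft Y Φ A * mulLeft Y Φ B := by
  ext C : 1
  apply Subtype.ext
  simp only [Module.End.mul_apply, coe_mulLeft_apply, Subalgebra.coe_mul, Matrix.mul_assoc]

/-- **The characters `χ_Y` are class functions**: `χ_Y(ab) = χ_Y(ba)`. [cite: Paulhus2008, p. 232 (virtual `ℚ`-characters of `End⁰`)] [cite: KaniRosen1989, Theorem A] -/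
theorem homCharacter_mul_comm (A B : endAlgRat Φ) :
    homCharacter Y Φ (A * B) = homCharacter Y Φ (B * A) := by
  rw [homCharacter_apply, homCharacter_apply, mulLeft_mul, mulLeft_mul, LinearMap.trace_mul_comm]

/-- `χ_Y(u ε u⁻¹) = χ_Y(ε)` for a unit `u` of `End_ℚ(X)`. [cite: Paulhus2008, p. 232] [cite: KaniRosen1989, Theorem A] -/
theorem homCharacter_conj (u : (endAlgRat Φ)ˣ) (A : endAlgRat Φ) :
    homCharacter Y Φ (↑u * A * ↑u⁻¹) = homCharacter Y Φ A := by
  rw [homCharacter_mul_comm, ← mul_assoc, Units.inv_mul, one_mul]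

/-- **Conjugate idempotents have isogenous images**: for an abelian variety `X`, an idempotent
`ε ∈ End_ℚ(X)` and a unit `u ∈ End_ℚ(X)ˣ`, `X^{uεu⁻¹} ∼ X^ε` — the case `n = m = 1` of Theorem A, the
relation `uεu⁻¹ ∼ ε` holding because characters are class functions.
[cite: KaniRosen1989, Theorem A] [cite: Paulhus2008, p. 232 Theorem 1] -/
theorem IsAbelianVariety.isIsogenous_idemPeriod_conj (hX : IsAbelianVariety Φ) {A : endAlgRat Φ}
    (hA : IsIdempotentElem A) (u : (endAlgRat Φ)ˣ) :
    IsIsogenous (idemPeriod Φ (↑u * A * ↑u⁻¹)) (idemPeriod Φ A) := by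
  have hA' : IsIdempotentElem (↑u * A * ↑u⁻¹ : endAlgRat Φ) := by
    rw [IsIdempotentElem]
    calc ↑u * A * ↑u⁻¹ * (↑u * A * ↑u⁻¹) = ↑u * A * (↑u⁻¹ * ↑u) * A * ↑u⁻¹ := by simp only [mul_assoc]
      _ = ↑u * (A * A) * ↑u⁻¹ := by rw [Units.inv_mul, mul_one, mul_assoc (↑u) A A]
      _ = ↑u * A * ↑u⁻¹ := by rw [hA]
  exact (isAbelianVariety_idemPeriod Φ hX _).isIsogenous_of_forall_finrank_homRat_eq
    (isAbelianVariety_idemPeriod Φ hX _) fun _ _ _ _ S _ ↦ by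
      have h := homCharacter_conj S Φ u A
      rw [homCharacter_eq_finrank S Φ hA', homCharacter_eq_finrank S Φ hA] at h
      exact_mod_cast h

end Conjugate

end ComplexTorus

end Literature.Geometry.Kaehler

end

-- build-artefact refresh 2026-08-23 (ops-buildfix-3 gen 18, incident B18-1): comment-only touch so that lake
-- rebuilds this module, whose hub/root `.olean` was page-truncated by the 18:18Z ENOSPC event; no declaration changed.
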